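import Summits.CriticalPhenomena.PercolationContinuityZ3.Theorems.PercNearOneGluingNoHeavyLowerTailAntitheticHarris
import Summits.CriticalPhenomena.PercolationContinuityZ3.Theorems.PercNearOneGluingNoHeavyLowerTailAntitheticTopVertex
import HarnessLib

/-!
# `NoHeavyLowerTail` (stmt-CriticalPhenomena-4575) — antithetic cluster pairs: **THE UP-SET LEMMA** — on every INCREASING event the
# shifted antithetic sum is bounded below by minus its diagonal fluctuation; **ST at pendant targets** (prim-hp-2 gen 73,
# HOME/THEOREM-TW.md §5, HOME/MEMO-gen73.md)

Support file (`--supports stmt-CriticalPhenomena-4575`, hull-port prover `prim-hp-2`, gen 73).  No definitions, no named facts, no sorries;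
standard axioms.  Notation: colourings `T ⊆ Sym2 V`, edge set `E`, source `s`, `X T = openCluster (T ∩ E) s`, `Y T = openCluster (Tᶜ ∩ E) s`,
shifted class `Φ(T) = (F⁺(X T) − F⁻(Y T))·(G⁺(X T) − G⁻(Y T))`, `F⁻ ≤ F⁺`, `G⁻ ≤ G⁺` monotone.

THEOREM U (`Antithetic.Upset.upset_diag_sum_nonneg`).  For EVERY finite edge set `E`, source `s`, every INCREASING event `𝒰` of colourings
(`T ⊆ T'`, `T ∈ 𝒰 ⇒ T' ∈ 𝒰`) and all monotone `F⁻ ≤ F⁺`, `G⁻ ≤ G⁺`: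
   `0 ≤ Σ_{T ∈ 𝒰} [ (F⁺(X T) − F⁻(Y T))(G⁺(X T) − G⁻(Y T)) + (F⁺(X T) − F⁺{s})(G⁺(X T) − G⁺{s}) ]`.
So the ⊕-sum `{P ∈ X}`, the top sum `{P ∈ X ∖ Y}`, the mixed sum `{P ∈ X, Q ∉ Y}`, cylinder sums … (all increasing events; several of them
CAN be negative: fan₆ hub −46, `K_{2,6}`+path −388, E₁₂ −91 189) are never below minus the DIAGONAL FLUCTUATION
`Σ_𝒰 (F⁺(X) − F⁺{s})(G⁺(X) − G⁺{s})`.  PROOF: four applications of Harris' inequality on the colouring cube (`Antithetic.harris_uniform`):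
with `A = F⁺(X) − F⁺{s} ≥ 0`, `B = G⁺(X) − G⁺{s} ≥ 0` increasing, `f = F⁻(Y) − F⁺{s}`, `g = G⁻(Y) − G⁺{s}` decreasing (any sign), split
`f = f₊ − f₋`, `g = g₊ − g₋`; the summand is `(AB − A g₊) + (AB − B f₊) + g₋(A − f₊) + f₋(B − g₊) + f₊g₊ + f₋g₋`, and each of
`Σ_𝒰 A g₊ ≤ Σ_𝒰 A B`, `Σ_𝒰 B f₊ ≤ Σ_𝒰 A B`, `Σ_𝒰 f₋ g₊ ≤ Σ_𝒰 f₋ B`, `Σ_𝒰 g₋ f₊ ≤ Σ_𝒰 g₋ A` is `cross ≤ same`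
(`Antithetic.Upset.cross_le_same_le`: `Φ ≥ 0` increasing, `ψ₂` decreasing, `ψ₁ ≥ 0` increasing, `Σ ψ₂ ≤ Σ ψ₁`), using
`Σ_T g₊(Y T) = Σ_T g₊(X T) ≤ Σ_T B(T)` (reflection `T ↦ Tᶜ`).
COROLLARY (`Antithetic.Upset.pendant_symmetrised_top_sum_nonneg`) — **CONJECTURE ST AT A PENDANT TARGET**: `K` an edge set missing the
vertex `P`, `a ≠ P`, `E = K + aP`, `s ≠ P`.  Then the SYMMETRISED TOP SUM of HOME/THEOREM-TW.md §4,
   `Σ_{T : P ∈ X_E T ∖ Y_E T} [ Φ(X_E T, Y_E T) + (F⁺(X_E T) − F⁻(Y^P_E T))(G⁺(X_E T) − G⁻(Y^P_E T)) ] ≥ 0`,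
`Y^P` = the blue cluster of `P` — here `{P}` on the top event — i.e. THEOREM U for the increasing event `{aP red, a ∈ X_K}` after
comparing `F⁻{P} ≤ F⁺{P} ≤ F⁺(X_E T)`.  (The plain top sum at a pendant target is the ⊕-sum of `(K, a)` and can be negative.)
[cite: VandenbergHaggstromKahn2005, §1 p. 6 ("Harris' inequality"), §1 p. 3 (open cluster `C_s`)]
-/

noncomputable section

namespace Summit.CriticalPhenomena.PercolationContinuityZ3.Theorems

open Literature.Probability.Percolation
open scoped Classical

namespace Antithetic

namespace Upset

section Lattice

variable {ι : Type*} [Fintype ι]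

/-- **`cross ≤ same` with an inequality of masses**: `Φ ≥ 0` increasing, `ψ₁ ≥ 0` increasing, `ψ₂` decreasing, `Σ ψ₂ ≤ Σ ψ₁`
imply `Σ Φ ψ₂ ≤ Σ Φ ψ₁` (Harris twice). [folklore] -/
theorem cross_le_same_le {Φ ψ₁ ψ₂ : Set ι → ℝ} (hΦ0 : ∀ a, 0 ≤ Φ a) (hΦ : Monotone Φ)
    (hψ₁0 : ∀ a, 0 ≤ ψ₁ a) (hψ₁ : Monotone ψ₁) (hψ₂ : Antitone ψ₂)
    (hsum : ∑ ω, ψ₂ ω ≤ ∑ ω, ψ₁ ω) : ∑ ω, Φ ω * ψ₂ ω ≤ ∑ ω, Φ ω * ψ₁ ω := by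
  set N : ℝ := (Fintype.card (Set ι) : ℝ) with hN
  have hNpos : (0 : ℝ) < N := by
    rw [hN]; exact_mod_cast Fintype.card_pos
  set M : ℝ := ψ₂ ∅ with hM
  have hψ₂M : ∀ a, ψ₂ a ≤ M := fun a => hψ₂ (Set.empty_subset a)
  -- Harris, both increasing
  have h1 : (∑ ω, Φ ω) * ∑ ω, ψ₁ ω ≤ N * ∑ ω, Φ ω * ψ₁ ω := harris_uniform hΦ0 hψ₁0 hΦ hψ₁
  -- Harris, increasing × (M − decreasing)
  have h2 := harris_uniform hΦ0 (g := fun ω => M - ψ₂ ω) (fun ω => sub_nonneg.2 (hψ₂M ω)) hΦ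
    (fun x y hxy => sub_le_sub_left (hψ₂ hxy) M)
  have e1 : ∑ ω, (M - ψ₂ ω) = N * M - ∑ ω, ψ₂ ω := by
    rw [Finset.sum_sub_distrib, Finset.sum_const, Finset.card_univ, nsmul_eq_mul]
  have e2 : ∑ ω, Φ ω * (M - ψ₂ ω) = M * ∑ ω, Φ ω - ∑ ω, Φ ω * ψ₂ ω := by
    have : ∀ ω, Φ ω * (M - ψ₂ ω) = M * Φ ω - Φ ω * ψ₂ ω := fun ω => by ring
    simp_rw [this]
    rw [Finset.sum_sub_distrib, ← Finset.mul_sum]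
  rw [e1, e2] at h2
  have hΦsum : 0 ≤ ∑ ω, Φ ω := Finset.sum_nonneg fun ω _ => hΦ0 ω
  have h3 : N * ∑ ω, Φ ω * ψ₂ ω ≤ (∑ ω, Φ ω) * ∑ ω, ψ₂ ω := by nlinarith
  have h4 : (∑ ω, Φ ω) * ∑ ω, ψ₂ ω ≤ (∑ ω, Φ ω) * ∑ ω, ψ₁ ω := mul_le_mul_of_nonneg_left hsum hΦsum
  exact le_of_mul_le_mul_left ((h3.trans h4).trans h1) hNpos

end Lattice

variable {V : Type*} [Fintype V]

/-- **THEOREM U (the up-set lemma).**  For every finite edge set `E`, source `s`, every increasing event `𝒰` of colourings and all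
monotone `F⁻ ≤ F⁺`, `G⁻ ≤ G⁺`:
`0 ≤ Σ_{T ∈ 𝒰} [ (F⁺(X T) − F⁻(Y T))(G⁺(X T) − G⁻(Y T)) + (F⁺(X T) − F⁺{s})(G⁺(X T) − G⁺{s}) ]`. [this work] -/
theorem upset_diag_sum_nonneg (E : Set (Sym2 V)) (s : V) (U : Set (Sym2 V) → Prop) [DecidablePred U]
    (hU : ∀ ⦃T T' : Set (Sym2 V)⦄, T ⊆ T' → U T → U T')
    (Fp Fm Gp Gm : Set V → ℝ) (hFp : Monotone Fp) (hFm : Monotone Fm) (hF : ∀ S, Fm S ≤ Fp S)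
    (hGp : Monotone Gp) (hGm : Monotone Gm) (hG : ∀ S, Gm S ≤ Gp S) :
    0 ≤ ∑ T ∈ Finset.univ.filter U,
      ((Fp (openCluster (T ∩ E) s) - Fm (openCluster (Tᶜ ∩ E) s)) * (Gp (openCluster (T ∩ E) s) - Gm (openCluster (Tᶜ ∩ E) s)) +
        (Fp (openCluster (T ∩ E) s) - Fp {s}) * (Gp (openCluster (T ∩ E) s) - Gp {s})) := by
  -- notation
  let X : Set (Sym2 V) → Set V := fun T => openCluster (T ∩ E) s
  let Y : Set (Sym2 V) → Set V := fun T => openCluster (Tᶜ ∩ E) s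
  have hXmono : Monotone X := fun T T' h => Freeze.openCluster_mono (Set.inter_subset_inter_left E h) s
  have hYanti : Antitone Y := fun T T' h => Freeze.openCluster_mono (Set.inter_subset_inter_left E (Set.compl_subset_compl.2 h)) s
  have hsX : ∀ T, ({s} : Set V) ⊆ X T := fun T => Set.singleton_subset_iff.2 (mem_openCluster_self _ s)
  -- the indicator of the event and the six functions of a colouring
  let u : Set (Sym2 V) → ℝ := fun T => if U T then 1 else 0
  let A : Set (Sym2 V) → ℝ := fun T => Fp (X T) - Fp {s}
  let B : Set (Sym2 V) → ℝ := fun T => Gp (X T) - Gp {s}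
  let f : Set (Sym2 V) → ℝ := fun T => Fm (Y T) - Fp {s}
  let g : Set (Sym2 V) → ℝ := fun T => Gm (Y T) - Gp {s}
  let fp : Set (Sym2 V) → ℝ := fun T => max (f T) 0
  let fn : Set (Sym2 V) → ℝ := fun T => max (-f T) 0
  let gp : Set (Sym2 V) → ℝ := fun T => max (g T) 0
  let gn : Set (Sym2 V) → ℝ := fun T => max (-g T) 0
  have hu0 : ∀ T, 0 ≤ u T := fun T => by simp only [u]; split_ifs <;> norm_num
  have hu1 : ∀ T, u T ≤ 1 := fun T => by simp only [u]; split_ifs <;> norm_num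
  have humono : Monotone u := by
    intro T T' h
    simp only [u]
    by_cases hT : U T
    · rw [if_pos hT, if_pos (hU h hT)]
    · rw [if_neg hT]; split_ifs <;> norm_num
  have hA0 : ∀ T, 0 ≤ A T := fun T => sub_nonneg.2 (hFp (hsX T))
  have hB0 : ∀ T, 0 ≤ B T := fun T => sub_nonneg.2 (hGp (hsX T))
  have hAmono : Monotone A := fun T T' h => sub_le_sub_right (hFp (hXmono h)) _
  have hBmono : Monotone B := fun T T' h => sub_le_sub_right (hGp (hXmono h)) _
  have hfanti : Antitone f := fun T T' h => sub_le_sub_right (hFm (hYanti h)) _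
  have hganti : Antitone g := fun T T' h => sub_le_sub_right (hGm (hYanti h)) _
  have hfp0 : ∀ T, 0 ≤ fp T := fun T => le_max_right _ _
  have hfn0 : ∀ T, 0 ≤ fn T := fun T => le_max_right _ _
  have hgp0 : ∀ T, 0 ≤ gp T := fun T => le_max_right _ _
  have hgn0 : ∀ T, 0 ≤ gn T := fun T => le_max_right _ _
  have hfpanti : Antitone fp := fun T T' h => max_le_max (hfanti h) le_rfl
  have hgpanti : Antitone gp := fun T T' h => max_le_max (hganti h) le_rfl
  have hfnmono : Monotone fn := fun T T' h => max_le_max (neg_le_neg (hfanti h)) le_rfl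
  have hgnmono : Monotone gn := fun T T' h => max_le_max (neg_le_neg (hganti h)) le_rfl
  have hf_eq : ∀ T, f T = fp T - fn T := fun T => by
    simp only [fp, fn]; rcases le_total (f T) 0 with h | h
    · rw [max_eq_right h, max_eq_left (neg_nonneg.2 h)]; ring
    · rw [max_eq_left h, max_eq_right (neg_nonpos.2 h)]; ring
  have hg_eq : ∀ T, g T = gp T - gn T := fun T => by
    simp only [gp, gn]; rcases le_total (g T) 0 with h | h
    · rw [max_eq_right h, max_eq_left (neg_nonneg.2 h)]; ring
    · rw [max_eq_left h, max_eq_right (neg_nonpos.2 h)]; ring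
  -- masses: Σ g₊(Y T) = Σ g₊(X T) ≤ Σ B, and the same for f
  have hmass_g : ∑ T, gp T ≤ ∑ T, B T := by
    have hrefl := TopVertex.sum_reflect E s (fun _ Bl => max (Gm Bl - Gp {s}) 0)
    -- Σ_T max(Gm(Y T) − Gp{s}, 0) = Σ_T max(Gm(X T) − Gp{s}, 0)
    have h1 : ∑ T, gp T = ∑ T : Set (Sym2 V), max (Gm (openCluster (T ∩ E) s) - Gp {s}) 0 := hrefl
    rw [h1]
    refine Finset.sum_le_sum fun T _ => max_le ?_ (hB0 T)
    exact sub_le_sub_right ((hG _).trans le_rfl) _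
  have hmass_f : ∑ T, fp T ≤ ∑ T, A T := by
    have hrefl := TopVertex.sum_reflect E s (fun _ Bl => max (Fm Bl - Fp {s}) 0)
    have h1 : ∑ T, fp T = ∑ T : Set (Sym2 V), max (Fm (openCluster (T ∩ E) s) - Fp {s}) 0 := hrefl
    rw [h1]
    refine Finset.sum_le_sum fun T _ => max_le ?_ (hA0 T)
    exact sub_le_sub_right ((hF _).trans le_rfl) _
  -- the four Harris inequalities
  have huA0 : ∀ T, 0 ≤ u T * A T := fun T => mul_nonneg (hu0 T) (hA0 T)
  have huB0 : ∀ T, 0 ≤ u T * B T := fun T => mul_nonneg (hu0 T) (hB0 T)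
  have hufn0 : ∀ T, 0 ≤ u T * fn T := fun T => mul_nonneg (hu0 T) (hfn0 T)
  have hugn0 : ∀ T, 0 ≤ u T * gn T := fun T => mul_nonneg (hu0 T) (hgn0 T)
  have huAmono : Monotone fun T => u T * A T := fun T T' h => mul_le_mul (humono h) (hAmono h) (hA0 T) (hu0 T')
  have huBmono : Monotone fun T => u T * B T := fun T T' h => mul_le_mul (humono h) (hBmono h) (hB0 T) (hu0 T')
  have hufnmono : Monotone fun T => u T * fn T := fun T T' h => mul_le_mul (humono h) (hfnmono h) (hfn0 T) (hu0 T')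
  have hugnmono : Monotone fun T => u T * gn T := fun T T' h => mul_le_mul (humono h) (hgnmono h) (hgn0 T) (hu0 T')
  have i1 : ∑ T, (u T * A T) * gp T ≤ ∑ T, (u T * A T) * B T := cross_le_same_le huA0 huAmono hB0 hBmono hgpanti hmass_g
  have i2 : ∑ T, (u T * B T) * fp T ≤ ∑ T, (u T * B T) * A T := cross_le_same_le huB0 huBmono hA0 hAmono hfpanti hmass_f
  have i3 : ∑ T, (u T * fn T) * gp T ≤ ∑ T, (u T * fn T) * B T := cross_le_same_le hufn0 hufnmono hB0 hBmono hgpanti hmass_g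
  have i4 : ∑ T, (u T * gn T) * fp T ≤ ∑ T, (u T * gn T) * A T := cross_le_same_le hugn0 hugnmono hA0 hAmono hfpanti hmass_f
  -- termwise identity and nonnegative remainder
  have hterm : ∀ T, u T * ((Fp (X T) - Fm (Y T)) * (Gp (X T) - Gm (Y T)) + (Fp (X T) - Fp {s}) * (Gp (X T) - Gp {s})) =
      ((u T * A T) * B T - (u T * A T) * gp T) + ((u T * B T) * A T - (u T * B T) * fp T) +
      ((u T * gn T) * A T - (u T * gn T) * fp T) + ((u T * fn T) * B T - (u T * fn T) * gp T) +
      u T * (fp T * gp T + fn T * gn T) := by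
    intro T
    have e1 : Fp (X T) - Fm (Y T) = A T - f T := by simp only [A, f]; ring
    have e2 : Gp (X T) - Gm (Y T) = B T - g T := by simp only [B, g]; ring
    rw [e1, e2, hf_eq T, hg_eq T]
    ring
  have hrest : 0 ≤ ∑ T, u T * (fp T * gp T + fn T * gn T) :=
    Finset.sum_nonneg fun T _ => mul_nonneg (hu0 T) (add_nonneg (mul_nonneg (hfp0 T) (hgp0 T)) (mul_nonneg (hfn0 T) (hgn0 T)))
  -- rewrite the filtered sum as a weighted sum over all colourings
  rw [Finset.sum_filter]
  have hsum : ∑ T : Set (Sym2 V), (if U T then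
        (Fp (X T) - Fm (Y T)) * (Gp (X T) - Gm (Y T)) + (Fp (X T) - Fp {s}) * (Gp (X T) - Gp {s}) else 0) =
      ∑ T : Set (Sym2 V), u T * ((Fp (X T) - Fm (Y T)) * (Gp (X T) - Gm (Y T)) + (Fp (X T) - Fp {s}) * (Gp (X T) - Gp {s})) := by
    refine Finset.sum_congr rfl fun T _ => ?_
    simp only [u]
    split_ifs <;> simp
  rw [hsum]
  simp_rw [hterm]
  rw [Finset.sum_add_distrib, Finset.sum_add_distrib, Finset.sum_add_distrib, Finset.sum_add_distrib,
    Finset.sum_sub_distrib, Finset.sum_sub_distrib, Finset.sum_sub_distrib, Finset.sum_sub_distrib]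
  linarith

/-- **The top sum is bounded below by minus the `P`-anchored diagonal (every graph).**  For every finite edge set `E`, `s`, `P` and all
monotone `F⁻ ≤ F⁺`, `G⁻ ≤ G⁺`:
`0 ≤ Σ_{T : P ∈ X T, P ∉ Y T} [ (F⁺(X T) − F⁻(Y T))(G⁺(X T) − G⁻(Y T)) + (F⁺(X T) − F⁻{P})(G⁺(X T) − G⁻{P}) ]`
(THEOREM U for the increasing top event and the functions `A ↦ F⁺(A ∪ {P})`, whose anchor `F⁺{s, P}` dominates `F⁻{P}`).
At a PENDANT target `P` (one pair `aP`, red on the top event, so that the blue cluster of `P` is `{P}`) this is exactly CONJECTURE ST of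
HOME/THEOREM-TW.md §4 — the symmetrised top sum `Σ_top [Φ(X, Y) + Φ(X, Y^P)]` — which therefore HOLDS AT EVERY PENDANT VERTEX of every
graph, although the plain top sum there is half the ⊕-sum of `(E − P, a)` and can be negative (fan₆ hub: −46). [this work] -/
theorem top_anchor_sum_nonneg (E : Set (Sym2 V)) (s P : V)
    (Fp Fm Gp Gm : Set V → ℝ) (hFp : Monotone Fp) (hFm : Monotone Fm) (hF : ∀ S, Fm S ≤ Fp S)
    (hGp : Monotone Gp) (hGm : Monotone Gm) (hG : ∀ S, Gm S ≤ Gp S) :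
    0 ≤ ∑ T ∈ Finset.univ.filter (fun T : Set (Sym2 V) => P ∈ openCluster (T ∩ E) s ∧ P ∉ openCluster (Tᶜ ∩ E) s),
      ((Fp (openCluster (T ∩ E) s) - Fm (openCluster (Tᶜ ∩ E) s)) * (Gp (openCluster (T ∩ E) s) - Gm (openCluster (Tᶜ ∩ E) s)) +
        (Fp (openCluster (T ∩ E) s) - Fm {P}) * (Gp (openCluster (T ∩ E) s) - Gm {P})) := by
  -- the top event is increasing
  have hU : ∀ ⦃T T' : Set (Sym2 V)⦄, T ⊆ T' →
      (P ∈ openCluster (T ∩ E) s ∧ P ∉ openCluster (Tᶜ ∩ E) s) → (P ∈ openCluster (T' ∩ E) s ∧ P ∉ openCluster (T'ᶜ ∩ E) s) := by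
    intro T T' h hT
    exact ⟨Freeze.openCluster_mono (Set.inter_subset_inter_left E h) s hT.1,
      fun h' => hT.2 (Freeze.openCluster_mono (Set.inter_subset_inter_left E (Set.compl_subset_compl.2 h)) s h')⟩
  -- THEOREM U with `F⁺(· ∪ {P})`, `G⁺(· ∪ {P})`
  have hFp' : Monotone fun A : Set V => Fp (insert P A) := fun A B h => hFp (Set.insert_subset_insert h)
  have hGp' : Monotone fun A : Set V => Gp (insert P A) := fun A B h => hGp (Set.insert_subset_insert h)
  have hF' : ∀ S, Fm S ≤ Fp (insert P S) := fun S => (hF S).trans (hFp (Set.subset_insert P S))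
  have hG' : ∀ S, Gm S ≤ Gp (insert P S) := fun S => (hG S).trans (hGp (Set.subset_insert P S))
  have hmain := upset_diag_sum_nonneg E s (fun T => P ∈ openCluster (T ∩ E) s ∧ P ∉ openCluster (Tᶜ ∩ E) s) hU
    (fun A => Fp (insert P A)) Fm (fun A => Gp (insert P A)) Gm hFp' hFm hF' hGp' hGm hG'
  have hmain' : 0 ≤ ∑ T ∈ Finset.univ.filter (fun T : Set (Sym2 V) => P ∈ openCluster (T ∩ E) s ∧ P ∉ openCluster (Tᶜ ∩ E) s),
      ((Fp (insert P (openCluster (T ∩ E) s)) - Fm (openCluster (Tᶜ ∩ E) s)) *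
          (Gp (insert P (openCluster (T ∩ E) s)) - Gm (openCluster (Tᶜ ∩ E) s)) +
        (Fp (insert P (openCluster (T ∩ E) s)) - Fp (insert P {s})) * (Gp (insert P (openCluster (T ∩ E) s)) - Gp (insert P {s}))) := by
    exact hmain
  refine hmain'.trans (Finset.sum_le_sum fun T hT => ?_)
  obtain ⟨-, hPX, -⟩ := Finset.mem_filter.1 hT
  have hins : insert P (openCluster (T ∩ E) s) = openCluster (T ∩ E) s := Set.insert_eq_of_mem hPX
  rw [hins]
  -- anchors: `F⁻{P} ≤ F⁺{P, s} ≤ F⁺(X T)`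
  have hsub : insert P ({s} : Set V) ⊆ openCluster (T ∩ E) s :=
    Set.insert_subset hPX (Set.singleton_subset_iff.2 (mem_openCluster_self _ s))
  have hPsub : ({P} : Set V) ⊆ insert P {s} := Set.singleton_subset_iff.2 (Set.mem_insert P _)
  have h1 : Fm {P} ≤ Fp (insert P {s}) := (hF {P}).trans (hFp hPsub)
  have h2 : Gm {P} ≤ Gp (insert P {s}) := (hG {P}).trans (hGp hPsub)
  have h3 : Fp (insert P {s}) ≤ Fp (openCluster (T ∩ E) s) := hFp hsub
  have h4 : Gp (insert P {s}) ≤ Gp (openCluster (T ∩ E) s) := hGp hsub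
  have hprod : (Fp (openCluster (T ∩ E) s) - Fp (insert P {s})) * (Gp (openCluster (T ∩ E) s) - Gp (insert P {s})) ≤
      (Fp (openCluster (T ∩ E) s) - Fm {P}) * (Gp (openCluster (T ∩ E) s) - Gm {P}) :=
    mul_le_mul (sub_le_sub_left h1 _) (sub_le_sub_left h2 _) (sub_nonneg.2 h4) (sub_nonneg.2 (h1.trans h3))
  linarith

end Upset


end Antithetic

end Summit.CriticalPhenomena.PercolationContinuityZ3.Theorems
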